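import Literature.NumberTheory.Sieve.LevelOfDistribution
import Literature.NumberTheory.Sieve.MoebiusCoprimeProgressions
import Mathlib.Data.ZMod.Units
import HarnessLib

/-!
# Type I sums in progressions with a monotone smooth factor — the "interleaving" bound

Trunk AntSieve, tooling toward the named fact `Literature.NumberTheory.Sieve.weakDHL_three_two_of_GEH`
(D. H. J. Polymath, Res. Math. Sci. 1:12 (2014) = arXiv:1407.4897, Theorem 3.2(xii)).  In the
deduction of `EH[ϑ]` from `GEH[ϑ]` (Proposition 2.7, "Vaughan's identity", p. 7) the two Type I terms
of Vaughan's identity, `μ_{≤U} ⋆ log` and `(μ_{≤U} ⋆ Λ_{≤V}) ⋆ 1`, are handled directly: a Dirichlet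
convolution `α ⋆ f` with `α` short and `f` MONOTONE has small discrepancy in every progression,
because the sums of a monotone nonnegative `f` over the residue classes `t (mod q)` in `[1, y]` all lie
within `2 f(y)` of each other (`abs_sum_filter_modEq_sub_le`, Abel summation against the class
counting functions, which differ by at most one).  Consequently (`typeI_apDiscrepancy_le`)
`|Δ((α ⋆ f) 1_{[1,x]}; a (q))| ≤ 2 f(x) Σ_{d ≤ x} |α(d)|` for every `q ≥ 1` and primitive `a` — no
main terms need to be computed.

## References

* [Polymath8b2014] D. H. J. Polymath, Res. Math. Sci. 1 (2014), Art. 12 = arXiv:1407.4897,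
  Proposition 2.7 (p. 7).
* [IwaniecKowalski2004] H. Iwaniec, E. Kowalski, *Analytic Number Theory*, §13.4 (Vaughan's
  identity; treatment of the Type I sums).
-/

noncomputable section

open Finset Real

namespace Literature.NumberTheory.Sieve

/-! ### Class counting functions differ by at most one -/

/-- The number of `c ∈ [1, y]` in the class `t (mod q)`. [folklore] -/
def classCount (q : ℕ) (t : ZMod q) (y : ℕ) : ℕ := #((Icc 1 y).filter fun c : ℕ => (c : ZMod q) = t)

/-- `classCount q t y ≤ y / q + 1`. [folklore] -/
theorem classCount_le {q : ℕ} (t : ZMod q) (y : ℕ) : classCount q t y ≤ y / q + 1 := by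
  unfold classCount
  refine le_trans (Finset.card_le_card ?_) (card_range_filter_natCast_eq_le q t y)
  intro c hc
  simp only [Finset.mem_filter, Finset.mem_Icc, Finset.mem_range] at hc ⊢
  exact ⟨by omega, hc.2⟩

/-- `y / q ≤ classCount q t y` for `q ≥ 1`: each block `(kq, (k+1)q]`, `k < y/q`, contains an element
of the class. [folklore] -/
theorem div_le_classCount {q : ℕ} (hq : 1 ≤ q) (t : ZMod q) (y : ℕ) : y / q ≤ classCount q t y := by
  haveI : NeZero q := ⟨by omega⟩
  -- least positive residue
  set r : ℕ := if t.val = 0 then q else t.val with hr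
  have hr1 : 1 ≤ r := by rw [hr]; split_ifs with h <;> omega
  have hrq : r ≤ q := by
    rw [hr]; split_ifs with h
    · exact le_rfl
    · exact (ZMod.val_lt t).le
  have hrt : ((r : ℕ) : ZMod q) = t := by
    rw [hr]; split_ifs with h
    · rw [ZMod.natCast_self]; exact ((ZMod.val_eq_zero t).1 h).symm
    · exact ZMod.natCast_zmod_val t
  unfold classCount
  calc y / q = #(range (y / q)) := (Finset.card_range _).symm
    _ ≤ _ := by
      refine Finset.card_le_card_of_injOn (fun k => k * q + r) ?_ ?_
      · intro k hk
        rw [Finset.mem_coe, Finset.mem_range] at hk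
        rw [Finset.mem_coe, Finset.mem_filter, Finset.mem_Icc]
        refine ⟨⟨le_add_left hr1, ?_⟩, ?_⟩
        · have h1 : (k + 1) * q ≤ y / q * q := Nat.mul_le_mul_right q hk
          have h2 : y / q * q ≤ y := Nat.div_mul_le_self y q
          nlinarith
        · push_cast
          rw [ZMod.natCast_self, mul_zero, zero_add, hrt]
      · intro k _ k' _ h
        have : k * q = k' * q := by
          have := h
          simp only at this
          omega
        exact Nat.eq_of_mul_eq_mul_right (by omega) this

/-- The class counting functions of two classes differ by at most one. [folklore] -/
theorem abs_classCount_sub_classCount_le {q : ℕ} (hq : 1 ≤ q) (t t' : ZMod q) (y : ℕ) :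
    |(classCount q t y : ℝ) - classCount q t' y| ≤ 1 := by
  have h1 := classCount_le t y
  have h2 := div_le_classCount hq t y
  have h3 := classCount_le t' y
  have h4 := div_le_classCount hq t' y
  rw [abs_le]
  constructor
  · have : (classCount q t' y : ℝ) ≤ (y / q : ℕ) + 1 := by exact_mod_cast h3
    have : ((y / q : ℕ) : ℝ) ≤ classCount q t y := by exact_mod_cast h2
    linarith
  · have : (classCount q t y : ℝ) ≤ (y / q : ℕ) + 1 := by exact_mod_cast h1
    have : ((y / q : ℕ) : ℝ) ≤ classCount q t' y := by exact_mod_cast h4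
    linarith

/-- `classCount` at `0`. [folklore] -/
theorem classCount_zero (q : ℕ) (t : ZMod q) : classCount q t 0 = 0 := by
  unfold classCount; simp

/-- Recursion: `classCount q t (c+1) = classCount q t c + [c+1 ≡ t]`. [folklore] -/
theorem classCount_succ (q : ℕ) (t : ZMod q) (c : ℕ) :
    (classCount q t (c + 1) : ℝ) = classCount q t c + if ((c + 1 : ℕ) : ZMod q) = t then 1 else 0 := by
  unfold classCount
  have : Icc 1 (c + 1) = insert (c + 1) (Icc 1 c) := by
    ext n; simp only [Finset.mem_Icc, Finset.mem_insert]; omega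
  rw [this, Finset.filter_insert]
  split_ifs with h
  · rw [Finset.card_insert_of_notMem (by simp)]
    push_cast; ring
  · simp

/-! ### Interleaving: class sums of a monotone function -/

/-- The class sum `Σ_{c ∈ [1,y], c ≡ t (q)} f(c)`. [folklore] -/
def classSum (f : ℕ → ℝ) (q : ℕ) (t : ZMod q) (y : ℕ) : ℝ :=
  ∑ c ∈ (Icc 1 y).filter (fun c : ℕ => (c : ZMod q) = t), f c

/-- Abel summation of the difference of two class sums against the class counting functions. [folklore] -/
theorem classSum_sub_classSum_eq (f : ℕ → ℝ) (q : ℕ) (t t' : ZMod q) (y : ℕ) :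
    classSum f q t y - classSum f q t' y =
      f y * ((classCount q t y : ℝ) - classCount q t' y) -
        ∑ c ∈ Ico 1 y, (f (c + 1) - f c) * ((classCount q t c : ℝ) - classCount q t' c) := by
  induction y with
  | zero => simp [classSum, classCount_zero]
  | succ y ih =>
    -- peel off the last term of both class sums
    have hs : ∀ s : ZMod q, classSum f q s (y + 1) = classSum f q s y +
        (if ((y + 1 : ℕ) : ZMod q) = s then f (y + 1) else 0) := by
      intro s
      unfold classSum
      have : Icc 1 (y + 1) = insert (y + 1) (Icc 1 y) := by
        ext n; simp only [Finset.mem_Icc, Finset.mem_insert]; omega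
      rw [this, Finset.filter_insert]
      split_ifs with h
      · rw [Finset.sum_insert (by simp), add_comm]
      · rw [add_zero]
    rw [hs t, hs t', classCount_succ, classCount_succ]
    rcases Nat.eq_zero_or_pos y with rfl | hy
    · simp [classSum, classCount_zero]
      split_ifs <;> ring
    · rw [← Nat.succ_pred_eq_of_pos hy] at ih ⊢
      rw [Finset.sum_Ico_succ_top (by omega : 1 ≤ y.pred + 1)]
      simp only [Nat.pred_eq_sub_one, Nat.succ_eq_add_one] at ih ⊢
      have e : y - 1 + 1 = y := by omega
      simp only [e] at ih ⊢
      rw [classSum, classSum] at ih ⊢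
      split_ifs <;> linear_combination ih

/-- **Interleaving bound**: for a monotone nonnegative `f` and any two classes `t, t' (mod q)`,
`q ≥ 1`: `|Σ_{c ≤ y, c ≡ t} f(c) − Σ_{c ≤ y, c ≡ t'} f(c)| ≤ 2 f(y)`. [folklore] -/
theorem abs_classSum_sub_classSum_le {f : ℕ → ℝ} (hf : Monotone f) (hf0 : ∀ n, 0 ≤ f n) {q : ℕ}
    (hq : 1 ≤ q) (t t' : ZMod q) (y : ℕ) :
    |classSum f q t y - classSum f q t' y| ≤ 2 * f y := by
  rw [classSum_sub_classSum_eq]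
  have h1 : |f y * ((classCount q t y : ℝ) - classCount q t' y)| ≤ f y := by
    rw [abs_mul, abs_of_nonneg (hf0 y)]
    exact mul_le_of_le_one_right (hf0 y) (abs_classCount_sub_classCount_le hq t t' y)
  have h2 : |∑ c ∈ Ico 1 y, (f (c + 1) - f c) * ((classCount q t c : ℝ) - classCount q t' c)| ≤ f y := by
    refine (Finset.abs_sum_le_sum_abs _ _).trans ?_
    have h3 : ∑ c ∈ Ico 1 y, |(f (c + 1) - f c) * ((classCount q t c : ℝ) - classCount q t' c)| ≤
        ∑ c ∈ Ico 1 y, (f (c + 1) - f c) := by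
      refine Finset.sum_le_sum fun c _ => ?_
      rw [abs_mul, abs_of_nonneg (sub_nonneg.2 (hf (Nat.le_succ c)))]
      exact mul_le_of_le_one_right (sub_nonneg.2 (hf (Nat.le_succ c)))
        (abs_classCount_sub_classCount_le hq t t' c)
    refine h3.trans ?_
    rcases Nat.eq_zero_or_pos y with rfl | hy
    · simp [hf0 0]
    · rw [Finset.sum_Ico_eq_sum_range]
      have : ∑ k ∈ range (y - 1), (f (1 + k + 1) - f (1 + k)) = f (1 + (y - 1)) - f 1 := by
        have := Finset.sum_range_sub (fun k => f (1 + k)) (y - 1)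
        simpa [add_assoc] using this
      rw [this, show 1 + (y - 1) = y by omega]
      linarith [hf0 1]
  have := abs_sub (f y * ((classCount q t y : ℝ) - classCount q t' y))
    (∑ c ∈ Ico 1 y, (f (c + 1) - f c) * ((classCount q t c : ℝ) - classCount q t' c))
  linarith

/-! ### The Type I discrepancy bound -/

/-- The indicator of the units as a sum of class indicators: for `q ≥ 1`,
`[(w, q) = 1] = Σ_{b ∈ (ℤ/qℤ)ˣ} [w ≡ b]`. [folklore] -/
theorem ite_coprime_eq_sum_units {q : ℕ} [NeZero q] (w : ℕ) :
    (if w.Coprime q then (1 : ℝ) else 0) = ∑ b : (ZMod q)ˣ, if (w : ZMod q) = b then (1 : ℝ) else 0 := by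
  by_cases hw : w.Coprime q
  · rw [if_pos hw]
    have key : ∀ b : (ZMod q)ˣ, ((w : ZMod q) = b ↔ b = ZMod.unitOfCoprime w hw) := by
      intro b
      constructor
      · intro h; ext; rw [← h]; rfl
      · intro h; rw [h]; rfl
    simp_rw [key]
    rw [Finset.sum_ite_eq']
    simp
  · rw [if_neg hw]
    symm
    refine Finset.sum_eq_zero fun b _ => ?_
    rw [if_neg]
    intro h
    apply hw
    rw [← ZMod.isUnit_iff_coprime, h]
    exact Units.isUnit b

/-- For `d` coprime to `q` (`q ≥ 1`), `dw ≡ a (q)` iff `w ≡ a d⁻¹ (q)`. [folklore] -/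
theorem natCast_mul_eq_iff {q : ℕ} {d : ℕ} (hd : d.Coprime q) (a : (ZMod q)ˣ) (w : ℕ) :
    ((d * w : ℕ) : ZMod q) = a ↔ (w : ZMod q) = ((a * (ZMod.unitOfCoprime d hd)⁻¹ : (ZMod q)ˣ) : ZMod q) := by
  set u : (ZMod q)ˣ := ZMod.unitOfCoprime d hd with hu
  have hdu : (u : ZMod q) = (d : ZMod q) := rfl
  rw [Units.val_mul]
  push_cast
  rw [← hdu]
  constructor
  · intro h
    calc (w : ZMod q) = (u⁻¹ : (ZMod q)ˣ) * ((u : ZMod q) * w) := (Units.inv_mul_cancel_left u _).symm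
      _ = (u⁻¹ : (ZMod q)ˣ) * (a : ZMod q) := by rw [h]
      _ = (a : ZMod q) * (u⁻¹ : (ZMod q)ˣ) := mul_comm _ _
  · intro h
    rw [h, mul_left_comm, Units.mul_inv, mul_one]

/-- **Type I discrepancy bound** (the Type I terms of Vaughan's identity in Proposition 2.7): for real
arithmetic functions `α`, `f` with `f` monotone and nonnegative, every `q ≥ 1`, primitive `a (q)`
and `x`: `|Δ((α ⋆ f) 1_{[1,x]}; a (q))| ≤ 2 f(x) Σ_{d ≤ x} |α(d)|`.  Proof: write
`Σ_{n ≤ x} c(n) (α ⋆ f)(n) = Σ_d α(d) Σ_{w ≤ x/d} f(w) c(dw)`; for `(d, q) = 1` the inner sums are a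
class sum of `f` (for `c = 1_{≡ a}`) and the sum over all primitive classes of the class sums (for
`c = 1_{(·,q)=1}`), so their combination `inner₁ − inner₂/φ(q)` is an average of differences of class
sums, each at most `2 f(x/d) ≤ 2 f(x)` by `abs_classSum_sub_classSum_le`; for `(d, q) > 1` both
inner sums vanish. [cite: Polymath8b2014, Proposition 2.7] [cite: IwaniecKowalski2004, §13.4] -/
theorem typeI_apDiscrepancy_le (α f : ArithmeticFunction ℝ) (hf : Monotone (f : ℕ → ℝ))
    (hf0 : ∀ n, 0 ≤ f n) {q : ℕ} (hq : 1 ≤ q) (a : (ZMod q)ˣ) (x : ℕ) :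
    |apDiscrepancy (fun n => (α * f) n) x q a| ≤ 2 * f x * ∑ d ∈ Icc 1 x, |α d| := by
  haveI : NeZero q := ⟨by omega⟩
  have hφ0 : (0 : ℝ) < Nat.totient q := by exact_mod_cast Nat.totient_pos.2 (by omega)
  have hφ : (Fintype.card (ZMod q)ˣ : ℝ) = Nat.totient q := by exact_mod_cast ZMod.card_units_eq_totient q
  -- the two sums, rearranged
  set c₁ : ℕ → ℝ := fun n => if (n : ZMod q) = a then 1 else 0 with hc₁
  set c₂ : ℕ → ℝ := fun n => if n.Coprime q then 1 else 0 with hc₂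
  have hS₁ : ∑ n ∈ (Icc 1 x).filter (fun n : ℕ => (n : ZMod q) = a), (α * f) n =
      ∑ d ∈ Icc 1 x, α d * ∑ w ∈ Icc 1 (x / d), f w * c₁ (d * w) := by
    rw [← sum_Icc_mul_dirichlet_eq, Finset.sum_filter]
    refine Finset.sum_congr rfl fun n _ => ?_
    rw [hc₁]
    simp only
    split_ifs <;> ring
  have hS₂ : ∑ n ∈ (Icc 1 x).filter (fun n : ℕ => n.Coprime q), (α * f) n =
      ∑ d ∈ Icc 1 x, α d * ∑ w ∈ Icc 1 (x / d), f w * c₂ (d * w) := by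
    rw [← sum_Icc_mul_dirichlet_eq, Finset.sum_filter]
    refine Finset.sum_congr rfl fun n _ => ?_
    rw [hc₂]
    simp only
    split_ifs <;> ring
  -- the inner combination is small for every `d`
  have hinner : ∀ d ∈ Icc 1 x,
      |(∑ w ∈ Icc 1 (x / d), f w * c₁ (d * w)) - (∑ w ∈ Icc 1 (x / d), f w * c₂ (d * w)) / Nat.totient q| ≤
        2 * f x := by
    intro d hd
    rw [Finset.mem_Icc] at hd
    have hfxd : f (x / d) ≤ f x := hf (Nat.div_le_self x d)
    by_cases hdq : d.Coprime q
    · -- `inner₁` is a class sum, `inner₂` the sum of all primitive class sums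
      set t : ZMod q := ((a * (ZMod.unitOfCoprime d hdq)⁻¹ : (ZMod q)ˣ) : ZMod q) with ht
      have h1 : ∑ w ∈ Icc 1 (x / d), f w * c₁ (d * w) = classSum f q t (x / d) := by
        rw [classSum, Finset.sum_filter]
        refine Finset.sum_congr rfl fun w _ => ?_
        rw [hc₁]
        simp only
        have hiff := natCast_mul_eq_iff hdq a w
        rw [← ht] at hiff
        by_cases hw : (w : ZMod q) = t
        · rw [if_pos (hiff.2 hw), if_pos hw, mul_one]
        · rw [if_neg (fun h => hw (hiff.1 h)), if_neg hw, mul_zero]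
      have h2 : ∑ w ∈ Icc 1 (x / d), f w * c₂ (d * w) = ∑ b : (ZMod q)ˣ, classSum f q (b : ZMod q) (x / d) := by
        have e : ∀ w, c₂ (d * w) = ∑ b : (ZMod q)ˣ, if (w : ZMod q) = b then (1 : ℝ) else 0 := by
          intro w
          rw [hc₂]
          simp only
          rw [← ite_coprime_eq_sum_units w]
          congr 1
          exact propext ⟨fun h => Nat.Coprime.coprime_mul_left h, fun h => Nat.Coprime.mul_left hdq h⟩
        simp_rw [e, Finset.mul_sum]
        rw [Finset.sum_comm]
        refine Finset.sum_congr rfl fun b _ => ?_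
        rw [classSum, Finset.sum_filter]
        refine Finset.sum_congr rfl fun w _ => ?_
        split_ifs <;> ring
      rw [h1, h2]
      -- average of differences
      have e : classSum f q t (x / d) - (∑ b : (ZMod q)ˣ, classSum f q (b : ZMod q) (x / d)) / Nat.totient q =
          (∑ b : (ZMod q)ˣ, (classSum f q t (x / d) - classSum f q (b : ZMod q) (x / d))) / Nat.totient q := by
        rw [Finset.sum_sub_distrib, Finset.sum_const, Finset.card_univ, nsmul_eq_mul, hφ]
        field_simp
      rw [e, abs_div, abs_of_pos hφ0, div_le_iff₀ hφ0]
      refine (Finset.abs_sum_le_sum_abs _ _).trans ?_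
      calc ∑ b : (ZMod q)ˣ, |classSum f q t (x / d) - classSum f q (b : ZMod q) (x / d)|
          ≤ ∑ _b : (ZMod q)ˣ, 2 * f x :=
            Finset.sum_le_sum fun b _ => (abs_classSum_sub_classSum_le hf hf0 hq t b (x / d)).trans (by linarith)
        _ = 2 * f x * Nat.totient q := by
            rw [Finset.sum_const, Finset.card_univ, nsmul_eq_mul, hφ]; ring
    · -- both inner sums vanish
      have h1 : ∀ w, c₁ (d * w) = 0 := by
        intro w
        rw [hc₁]
        simp only
        rw [if_neg]
        intro h
        apply hdq
        have hu : IsUnit ((d * w : ℕ) : ZMod q) := by rw [h]; exact Units.isUnit a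
        rw [ZMod.isUnit_iff_coprime] at hu
        exact Nat.Coprime.coprime_mul_right hu
      have h2 : ∀ w, c₂ (d * w) = 0 := by
        intro w
        rw [hc₂]
        simp only
        rw [if_neg]
        intro h
        exact hdq (Nat.Coprime.coprime_mul_right h)
      simp only [h1, h2, mul_zero, Finset.sum_const_zero, zero_div, sub_zero, abs_zero]
      linarith [hf0 x]
  -- assemble
  unfold apDiscrepancy
  rw [hS₁, hS₂, Finset.sum_div, ← Finset.sum_sub_distrib, Finset.mul_sum]
  refine (Finset.abs_sum_le_sum_abs _ _).trans (Finset.sum_le_sum fun d hd => ?_)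
  rw [mul_div_assoc, ← mul_sub, abs_mul]
  rw [mul_comm (2 * f x)]
  exact mul_le_mul_of_nonneg_left (hinner d hd) (abs_nonneg _)

end Literature.NumberTheory.Sieve
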